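import Summits.BirchSwinnertonDyer.BirchSwinnertonDyer.Theorems.ByReductionTypeAtTwoMultLowerHalfSelmerRankSplit
import Summits.BirchSwinnertonDyer.BirchSwinnertonDyer.Theorems.ByReductionTypeAtTwoMultTowerPinch
import Summits.BirchSwinnertonDyer.BirchSwinnertonDyer.Theorems.ByReductionTypeAtTwoTowerClassKit
import HarnessLib

/-!
# Route `ByReductionTypeAtTwo`, children `MultLowerHalfAtTwo` (item stmt-BirchSwinnertonDyer-19923) / `MultUpperHalfAtTwo`
# (19922): the multiplicative-at-`2` pinch doors in DISPLAY FORM — every PRINT input BY NAME, the period datum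
# `hper₀` discharged by Česnavičius, `hlow` discharged by Prop. 4.14@2 + a layer count; what is left displayed is
# exactly {Kato at `2` (MEMO)} [+ GS at a split `2`] + engine certificates + the curve's decidable data

HONEST FRAMING (cell `bsd-2adic`, run/shared/lean/pub/bsd-2adic/, seat `bsd-2adic-mult-3` GEN 6, HUMAN RULINGS
D-0036 / D-0054 / D-0074 row (A)): research route; THEOREMS ONLY — no definition, no new named fact, nothing asserted,
nothing booked; BSD is not proved by any of this. PARTITION (D-0054): X5@2 mult, `E[2]` irreducible (K4ᵐ,
RESIDUAL-MAP B1·O1; 1 680 of the 1 976 book230 classes; first the 66 + 97 + 36 TIER-1 rows) × p = 2 —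
types-the-object-of (items 19923 / 19922 per class: the row display); closes none by itself.

WHY. The cell prices a class row by its displayed binders (planner GEN 15, 12:32:34Z: «after it lands the tier-1 INT
rows display PRINT + CERT + the ONE memo binder hK [+ hGS on split]»). Two displayed binders of the INT / tower
doors are theorems on the doors' own locus and are discharged here once and for all:
* `hper₀ : 0 ≤ ord₂ ϖ` — on a curve multiplicative at `2` with `E[2]` irreducible, `ord₂ ϖ = 0` for every period
  ratio of the newform (Česnavičius 2018 Thm. 1.2: `2 ∥ N ⇒` the Manin constant is odd; odd isogenies inside the
  class; tree: `Theorems.padicValRat_periodRatio_eq_zero_of_irr_two`, mult-2, from the Literature named fact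
  `cesnavicius_not_two_dvd_maninConstant_of_two_dvd_level`, PRINT `hC`); `E[2]` irreducible is automatic from the
  `TwoAdicSurjective` certificate (`irr_two_of_twoAdicSurjective`);
* `hlow : SelmerLambdaLowerBoundAtTwo W n` — PRINT Prop. 4.14@2 (`h414`) + ONE layer count (`hsel`), this seat
  (`selmerLambdaLowerBoundAtTwo_of_layerSelmer`, p445915).
So, per road:
* §1 NON-SPLIT INT (T-KATO2-NSMULT): `bsdp_two_nonsplit_of_katoInt_display` — PRINT {guarded Thm-4.1 analogue `h41`,
  `hmod`, `hGZK`, `h414`, `hC`} + MEMO {`hKint`} + CERT {`λ_an = n`, `μ_an = 0`, `2^n ≤ #Sel_{2^∞}(E/ℚ_j)[2]`} +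
  decidable {`Mult W 2`, non-split, `TwoAdicSurjective W`, `Δ < 0`} + `r_an = 0` ⟹ `BSDp W 2`; the layer-`0`
  `κ`-free form `…_display₀`; the `2`-converse `analyticRank_eq_zero_of_finite_selmer_of_katoInt_display`; the
  instances `missingLowerBoundAt_two_nonsplit_of_katoInt_display` (19923) and — with NO certificate at all —
  `missingUpperBoundAt_two_nonsplit_of_katoInt_display` (19922: PRINT + MEMO {`hKint`} only).
* §2 SPLIT `Δ > 0` face (p443104): `bsdp_two_split_of_katoUpToOnePinch_of_mu_display` — `htors` and `hper₀`
  discharged from a `TwoAdicSurjective` certificate + `hC`. (The split `Δ < 0` INT door has no period datum: its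
  display form is already `MultSelmerRank.bsdp_two_split_of_katoInt_of_layerSelmer`, p446547.)
* §3 TOWER λ-pinch road (K11, p446877) on an `E[2]`-IRREDUCIBLE curve: `bsdp_two_{nonsplit,split}_of_katoRat_of_towerGap_display`
  — PRINT {`h41`/A236 (+GS), `hmod`, `hGZK`, `h414`, `hC`} + MEMO {K11 `hKato`} + CERT {tower gap, layer count,
  `λ_an`, `μ_an`} + `Irr W 2`.

WHAT IS DISPLAYED, NOT PROVED (numbers, not adjectives): MEMO T-KATO2-NSMULT / the slack-one split datum / K11 (one
per road), the named fact `greenberg_stevens W 2` beyond its printed range on split rows, the `μ(X) = 0` hypothesis of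
the `Δ > 0` face; PRINT by name: `h41`/A236, `hmod`, `hGZK`, `h414` (audit h414 PASS), `hC`; certificates = engine
numbers of record (two-engine `λ_an`/`μ_an` on 1 969/1 976; `dim Sel₂(E/ℚ) = 2`, `t = 0` two-engine on every X5
member; layer `j ≥ 1` counts and tower gaps NOT yet run on multiplicative classes — kit j254728 (this seat) is the
first layer-1 run, on the 4 K = 4 singletons of item 19923). ∀-LEVEL CONTENT: none.

References: K. Česnavičius, *The Manin constant in the semistable case*, Compos. Math. 154 (2018), Thm. 1.2;
R. Greenberg, LNM 1716 (1999), §4 pp. 112–113, Prop. 4.14 (p. 124); K. Kato, Astérisque 295 (2004), 17.4, 17.13;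
B. Mazur, J. Tate, J. Teitelbaum, Invent. Math. 84 (1986), §I.14–15; R. L. Miller, LMS J. Comput. Math. 14 (2011),
Def. 1.1; J.-P. Serre, Invent. Math. 15 (1972), §4.
-/

set_option autoImplicit false
set_option linter.dupNamespace false

noncomputable section

open scoped Classical MatrixGroups ModularForm

open CongruenceSubgroup WeierstrassCurve Literature.NumberTheory.EllipticCurves
  Literature.NumberTheory.EllipticCurves.ModularForms
  Literature.NumberTheory.EllipticCurves.Greenberg1999
  Literature.NumberTheory.EllipticCurves.Rank1Residual
  Literature.NumberTheory.EllipticCurves.Rank1Residual.Typed Summit.BirchSwinnertonDyer.Rank1Residual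
  Summit.BirchSwinnertonDyer.Rank1Residual.X5 Summit.BirchSwinnertonDyer.Rank1Residual.X5.O1

namespace Summit.BirchSwinnertonDyer.BirchSwinnertonDyer.Theorems.MultSelmerRank

variable (W : WeierstrassCurve ℚ) [W.IsElliptic] [W.IsGloballyMinimal]

/-! ## §0 The period datum on the doors' locus -/

/-- **`hper₀` DISCHARGED on the doors' locus.** `W` multiplicative at `2` with `ρ_{E,2^∞}` surjective (so `E[2]`
irreducible): every period ratio `ϖ` (`ϖ·Ω_E = Ω⁺_f`) of a newform of `W` has `ord₂ ϖ = 0 ≥ 0` — Česnavičius 2018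
Thm. 1.2 (`2 ∥ N` ⇒ odd Manin constant) + odd isogenies, via mult-2's `padicValRat_periodRatio_eq_zero_of_irr_two`
from the named fact `hC`. [cite: Cesnavicius2018, Thm. 1.2] [cite: Serre1972, §4] -/
theorem periodRatio_nonneg_of_twoAdicSurjective_of_cesnavicius
    (hC : cesnavicius_not_two_dvd_maninConstant_of_two_dvd_level) (hmult : Mult W 2) (him : TwoAdicSurjective W) :
    ∀ [NeZero (W.conductorNorm ℤ)] (f : CuspForm (Gamma0 (W.conductorNorm ℤ)) 2),
      IsNewformOf W f → ∀ ϖ : ℚ, (ϖ : ℝ) * W.realPeriodRat = plusPeriod f → 0 ≤ padicValRat 2 ϖ :=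
  fun f hf ϖ hϖ =>
    (padicValRat_periodRatio_eq_zero_of_irr_two hC W hmult (irr_two_of_twoAdicSurjective W him) f hf ϖ hϖ).ge

/-- The same from `Irr W 2` directly (the tower road's habitat). [cite: Cesnavicius2018, Thm. 1.2] -/
theorem periodRatio_nonneg_of_irr_of_cesnavicius
    (hC : cesnavicius_not_two_dvd_maninConstant_of_two_dvd_level) (hmult : Mult W 2) (hirr : Irr W 2) :
    ∀ [NeZero (W.conductorNorm ℤ)] (f : CuspForm (Gamma0 (W.conductorNorm ℤ)) 2),
      IsNewformOf W f → ∀ ϖ : ℚ, (ϖ : ℝ) * W.realPeriodRat = plusPeriod f → 0 ≤ padicValRat 2 ϖ :=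
  fun f hf ϖ hϖ => (padicValRat_periodRatio_eq_zero_of_irr_two hC W hmult hirr f hf ϖ hϖ).ge

/-! ## §1 The NON-SPLIT INT door in display form -/

/-- **TIER-1/2 NON-SPLIT ROW, DISPLAY FORM: `BSDp W 2`** from PRINT {guarded Thm-4.1 analogue `h41`, modularity
`hmod`, GZK `hGZK`, Greenberg Prop. 4.14@2 `h414`, Česnavičius `hC`} + MEMO {T-KATO2-NSMULT `hKint`} + CERTIFICATES
{`λ_an(E) = n` (`hlan`), `μ_an(E) = 0` (`hμan`), the layer count `2^n ≤ #Sel_{2^∞}(E/ℚ_j)[2]` (`hsel`)} + the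
curve's decidable data {`Mult W 2`, non-split, `TwoAdicSurjective W`, `Δ < 0`} + analytic rank `0`. Nothing else:
no `hper₀`, no `hlow`, no reference curve, no `2`-torsion point, no tower gap.
[cite: GreenbergLNM1716, §4 pp. 112–113 and Prop. 4.14 (p. 124)] [cite: Cesnavicius2018, Thm. 1.2]
[cite: MazurTateTeitelbaum1986Invent, §I.14] [cite: Miller2011LMS, Def. 1.1 and §1] -/
theorem bsdp_two_nonsplit_of_katoInt_display {j n : ℕ}
    (h41 : thm41Analogue_charValue_rankZero_numberField_anyPrime_oddLocalDegree)
    (hmod : nonempty_modularParametrizationData)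
    (hGZK : rank_eq_analyticRank_of_analyticRank_le_one)
    (h414 : prop414_noFiniteSubmodule_of_not_dvd_torsionOrder)
    (hC : cesnavicius_not_two_dvd_maninConstant_of_two_dvd_level)
    (hKint : KatoDivisibilityAtTwoNonsplitMultInt W)
    (hr : W.analyticRank = 0) (hmult : Mult W 2) (hns : ¬ W.HasSplitMultiplicativeReductionAtPrime 2)
    (him : TwoAdicSurjective W) (hΔ : W.Δ < 0)
    (hlan : X2.AnalyticLambdaEq W 2 n) (hμan : X2.AnalyticMuLE W 2 0)
    (hsel : ∀ κ : ZpExtension ℚ 2, κ.IsCyclotomic →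
      2 ^ n ≤ Nat.card {z : W.selmerLayer κ j // 2 • z = 0}) : BSDp W 2 :=
  bsdp_two_nonsplit_of_katoInt_of_layerSelmer W h41 hmod hGZK h414 hKint
    (periodRatio_nonneg_of_twoAdicSurjective_of_cesnavicius W hC hmult him) hr hmult hns him hΔ hlan hμan hsel

/-- **TIER-1 NON-SPLIT ROW, DISPLAY FORM, layer-`0` certificate `κ`-free** (`2^n ≤ #Sel_{2^∞}(E/ℚ)[2]`; `n = 2`
on the 66 tier-1 rows). [cite: GreenbergLNM1716, §4 pp. 112–113 and Prop. 4.14 (p. 124)]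
[cite: Cesnavicius2018, Thm. 1.2] [cite: Miller2011LMS, Def. 1.1 and §1] -/
theorem bsdp_two_nonsplit_of_katoInt_display₀ {n : ℕ}
    (h41 : thm41Analogue_charValue_rankZero_numberField_anyPrime_oddLocalDegree)
    (hmod : nonempty_modularParametrizationData)
    (hGZK : rank_eq_analyticRank_of_analyticRank_le_one)
    (h414 : prop414_noFiniteSubmodule_of_not_dvd_torsionOrder)
    (hC : cesnavicius_not_two_dvd_maninConstant_of_two_dvd_level)
    (hKint : KatoDivisibilityAtTwoNonsplitMultInt W)
    (hr : W.analyticRank = 0) (hmult : Mult W 2) (hns : ¬ W.HasSplitMultiplicativeReductionAtPrime 2)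
    (him : TwoAdicSurjective W) (hΔ : W.Δ < 0)
    (hlan : X2.AnalyticLambdaEq W 2 n) (hμan : X2.AnalyticMuLE W 2 0)
    (hsel : 2 ^ n ≤ Nat.card {z : W.selmerGroupPInfty 2 // 2 • z = 0}) : BSDp W 2 :=
  bsdp_two_nonsplit_of_katoInt_of_selmerTwoTorsion W h41 hmod hGZK h414 hKint
    (periodRatio_nonneg_of_twoAdicSurjective_of_cesnavicius W hC hmult him) hr hmult hns him hΔ hlan hμan hsel

/-- **TIER-1/2 NON-SPLIT ROW, CONVERSE, DISPLAY FORM** (S3ᵐ lane): `Sel_{2^∞}(E/ℚ)` finite ⇒ `L(E,1) ≠ 0 ∧ r_an = 0`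
from PRINT {`h41`, `hmod`, `h414`, `hC`} + MEMO {`hKint`} + CERT {`hlan`, `hμan`, `hsel`} + decidable data.
[cite: GreenbergLNM1716, §4 pp. 112–113 and Prop. 4.14 (p. 124)] [cite: Cesnavicius2018, Thm. 1.2]
[cite: MazurTateTeitelbaum1986Invent, §I.14] -/
theorem analyticRank_eq_zero_of_finite_selmer_of_katoInt_display {j n : ℕ}
    (h41 : thm41Analogue_charValue_rankZero_numberField_anyPrime_oddLocalDegree)
    (hmod : nonempty_modularParametrizationData)
    (h414 : prop414_noFiniteSubmodule_of_not_dvd_torsionOrder)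
    (hC : cesnavicius_not_two_dvd_maninConstant_of_two_dvd_level)
    (hKint : KatoDivisibilityAtTwoNonsplitMultInt W)
    (hmult : Mult W 2) (hns : ¬ W.HasSplitMultiplicativeReductionAtPrime 2)
    (him : TwoAdicSurjective W) (hΔ : W.Δ < 0)
    (hlan : X2.AnalyticLambdaEq W 2 n) (hμan : X2.AnalyticMuLE W 2 0)
    (hsel : ∀ κ : ZpExtension ℚ 2, κ.IsCyclotomic →
      2 ^ n ≤ Nat.card {z : W.selmerLayer κ j // 2 • z = 0})
    (hfin : Finite (W.selmerGroupPInfty 2)) : W.entireLFunction 1 ≠ 0 ∧ W.analyticRank = 0 :=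
  analyticRank_eq_zero_of_finite_selmer_of_katoInt_of_layerSelmer W h41 hmod h414 hKint
    (periodRatio_nonneg_of_twoAdicSurjective_of_cesnavicius W hC hmult him) hmult hns him hΔ hlan hμan hsel hfin

/-- **Item 19923 AT a tier-1/2 non-split row, DISPLAY FORM: `Typed.MissingLowerBoundAt W 2`.**
[cite: Miller2011LMS, Def. 1.1 (arXiv:1010.2431 p. 3)] [cite: GreenbergLNM1716, Prop. 4.14 (p. 124)] [cite: Cesnavicius2018, Thm. 1.2] -/
theorem missingLowerBoundAt_two_nonsplit_of_katoInt_display {j n : ℕ}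
    (h41 : thm41Analogue_charValue_rankZero_numberField_anyPrime_oddLocalDegree)
    (hmod : nonempty_modularParametrizationData)
    (hGZK : rank_eq_analyticRank_of_analyticRank_le_one)
    (h414 : prop414_noFiniteSubmodule_of_not_dvd_torsionOrder)
    (hC : cesnavicius_not_two_dvd_maninConstant_of_two_dvd_level)
    (hKint : KatoDivisibilityAtTwoNonsplitMultInt W)
    (hr : W.analyticRank = 0) (hmult : Mult W 2) (hns : ¬ W.HasSplitMultiplicativeReductionAtPrime 2)
    (him : TwoAdicSurjective W) (hΔ : W.Δ < 0)
    (hlan : X2.AnalyticLambdaEq W 2 n) (hμan : X2.AnalyticMuLE W 2 0)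
    (hsel : ∀ κ : ZpExtension ℚ 2, κ.IsCyclotomic →
      2 ^ n ≤ Nat.card {z : W.selmerLayer κ j // 2 • z = 0}) : MissingLowerBoundAt W 2 :=
  missingLowerBoundAt_two_nonsplit_of_katoInt_of_layerSelmer W h41 hmod hGZK h414 hKint
    (periodRatio_nonneg_of_twoAdicSurjective_of_cesnavicius W hC hmult him) hr hmult hns him hΔ hlan hμan hsel

/-- **Item 19922 AT a non-split surjective `Δ < 0` row, DISPLAY FORM, NO certificate: `Typed.MissingUpperBoundAt W 2`**
from PRINT {`h41`, `hmod`, `hGZK`, `hC`} + MEMO {`hKint`} + decidable data + `r_an = 0` (twin door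
`X5.O1.missingUpperBoundAt_two_nonsplit_of_katoInt'`, p428361, with `hper₀` discharged).
[cite: GreenbergLNM1716, §4 pp. 112–113] [cite: Cesnavicius2018, Thm. 1.2] [cite: Miller2011LMS, Def. 1.1] -/
theorem missingUpperBoundAt_two_nonsplit_of_katoInt_display
    (h41 : thm41Analogue_charValue_rankZero_numberField_anyPrime_oddLocalDegree)
    (hmod : nonempty_modularParametrizationData)
    (hGZK : rank_eq_analyticRank_of_analyticRank_le_one)
    (hC : cesnavicius_not_two_dvd_maninConstant_of_two_dvd_level)
    (hKint : KatoDivisibilityAtTwoNonsplitMultInt W)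
    (hr : W.analyticRank = 0) (hmult : Mult W 2) (hns : ¬ W.HasSplitMultiplicativeReductionAtPrime 2)
    (him : TwoAdicSurjective W) (hΔ : W.Δ < 0) : MissingUpperBoundAt W 2 :=
  missingUpperBoundAt_two_nonsplit_of_katoInt' W h41 hmod hGZK hKint
    (periodRatio_nonneg_of_twoAdicSurjective_of_cesnavicius W hC hmult him) hr hmult hns him hΔ

/-! ## §2 The SPLIT `Δ > 0` face in display form -/

/-- **TIER-1 SPLIT `Δ > 0` ROW, DISPLAY FORM: `BSDp W 2`** from PRINT {A236 `h41`, `hmod`, `hGZK`, `h414`, `hC`} + the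
named fact `greenberg_stevens W 2` + MEMO {the slack-one datum `hK1sp`} + the HYPOTHESIS `hμX` (`μ(X) = 0`, displayed)
+ CERT {`hlan` (`n + 1`), `hμan`, `hsel`} + decidable {`Mult W 2`, split, `TwoAdicSurjective W`} + `r_an = 0`;
`htors` and `hper₀` of p443104 discharged from the surjectivity certificate and `hC`.
[cite: GreenbergLNM1716, §4 pp. 112–113 (split l_v), Conj. 1.11 and Prop. 4.14 (p. 124)] [cite: Cesnavicius2018, Thm. 1.2]
[cite: MazurTateTeitelbaum1986Invent, §I.10, §I.14–15 and §II] [cite: Miller2011LMS, Def. 1.1 and §1] -/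
theorem bsdp_two_split_of_katoUpToOnePinch_of_mu_display {j n : ℕ}
    (h41 : thm41Analogue_charValue_rankZero_split_baseChange_anyPrime)
    (hGS : greenberg_stevens (W := W) (p := 2))
    (hmod : nonempty_modularParametrizationData)
    (hGZK : rank_eq_analyticRank_of_analyticRank_le_one)
    (h414 : prop414_noFiniteSubmodule_of_not_dvd_torsionOrder)
    (hC : cesnavicius_not_two_dvd_maninConstant_of_two_dvd_level)
    (hK1sp : ∀ (κ : ZpExtension ℚ 2) (γ : Field.absoluteGaloisGroup ℚ), κ.IsCyclotomic →
      κ.IsTopGenerator γ → IsCyclotomicVariable 2 γ →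
      ∀ [NeZero (W.conductorNorm ℤ)] (f : CuspForm (Gamma0 (W.conductorNorm ℤ)) 2), IsNewformOf W f →
      ∀ ϖ : ℚ, (ϖ : ℝ) * W.realPeriodRat = plusPeriod f →
      ∀ L : PowerSeries ℚ_[2], IsSplitMultPAdicLFunctionOf f 2 L → ∀ D : W.SelmerDualData κ γ,
        D.IsTorsion ∧ ∃ g ∈ D.charIdeal,
          iwasawaToPowerSeries 2 (PowerSeries.X * g) = PowerSeries.C ((2 * ϖ : ℚ) : ℚ_[2]) * L)
    (hμX : ∀ (κ : ZpExtension ℚ 2) (γ : Field.absoluteGaloisGroup ℚ), κ.IsCyclotomic →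
      κ.IsTopGenerator γ → IsCyclotomicVariable 2 γ → ∀ D : W.SelmerDualData κ γ, D.IsTorsion → D.mu = 0)
    (hr : W.analyticRank = 0) (hmult : Mult W 2) (hsp : W.HasSplitMultiplicativeReductionAtPrime 2)
    (him : TwoAdicSurjective W)
    (hlan : X2.AnalyticLambdaEq W 2 (n + 1)) (hμan : X2.AnalyticMuLE W 2 0)
    (hsel : ∀ κ : ZpExtension ℚ 2, κ.IsCyclotomic →
      2 ^ n ≤ Nat.card {z : W.selmerLayer κ j // 2 • z = 0}) : BSDp W 2 :=
  bsdp_two_split_of_katoUpToOnePinch_of_mu_of_layerSelmer W h41 hGS hmod hGZK h414 hK1sp hμX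
    (periodRatio_nonneg_of_twoAdicSurjective_of_cesnavicius W hC hmult him)
    (not_two_dvd_torsionOrder_of_twoAdicSurjective W him) hr hmult hsp hlan hμan hsel

/-! ## §3 The TOWER λ-pinch road (K11) on an `E[2]`-irreducible curve, display form -/

/-- **TOWER λ-PINCH ROW (non-split), DISPLAY FORM: `BSDp W 2`** from PRINT {`h41`, `hmod`, `hGZK`, `h414`, `hC`} + MEMO
{K11 `hKato`} + CERT {`TowerGapAtTwo W`, layer count, `λ_an = n`, `μ_an = 0`} + `Irr W 2` + {`Mult W 2`, non-split,
`r_an = 0`}; `htors` (ord-2's `TowerClass.not_two_dvd_torsionOrder_of_irr`) and `hper₀` of p446877 discharged. [cite: Kato2004Asterisque, Thm. 17.4 (p. 273) and 17.13]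
[cite: GreenbergLNM1716, §4 pp. 112–113 and Prop. 4.14 (p. 124)] [cite: Cesnavicius2018, Thm. 1.2] [cite: Miller2011LMS, Def. 1.1] -/
theorem bsdp_two_nonsplit_of_katoRat_of_towerGap_display {j n : ℕ}
    (hKato : O1.KatoMultiplicativeDivisibilityRat W 2)
    (h41 : thm41Analogue_charValue_rankZero_numberField_anyPrime_oddLocalDegree)
    (hmod : nonempty_modularParametrizationData)
    (hGZK : rank_eq_analyticRank_of_analyticRank_le_one)
    (h414 : prop414_noFiniteSubmodule_of_not_dvd_torsionOrder)
    (hC : cesnavicius_not_two_dvd_maninConstant_of_two_dvd_level)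
    (hgap : TowerGapAtTwo W) (hirr : Irr W 2)
    (hr : W.analyticRank = 0) (hmult : Mult W 2) (hns : ¬ W.HasSplitMultiplicativeReductionAtPrime 2)
    (hlan : X2.AnalyticLambdaEq W 2 n) (hμan : X2.AnalyticMuLE W 2 0)
    (hsel : ∀ κ : ZpExtension ℚ 2, κ.IsCyclotomic →
      2 ^ n ≤ Nat.card {z : W.selmerLayer κ j // 2 • z = 0}) : BSDp W 2 :=
  bsdp_two_nonsplit_of_katoRat_of_towerGap_of_layerSelmer W hKato h41 hmod hGZK h414
    (periodRatio_nonneg_of_irr_of_cesnavicius W hC hmult hirr) hgap (TowerClass.not_two_dvd_torsionOrder_of_irr W hirr) hr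
    hmult hns hlan hμan hsel

/-- **TOWER λ-PINCH ROW (split), DISPLAY FORM: `BSDp W 2`** from PRINT {A236 `h41sp`, `hmod`, `hGZK`, `h414`, `hC`} +
`greenberg_stevens W 2` + MEMO {K11 `hKato`} + CERT {tower gap, layer count, `λ_an = n + 1`, `μ_an = 0`} + `Irr W 2`
+ {`Mult W 2`, split, `r_an = 0`}. [cite: Kato2004Asterisque, Thm. 17.4 (p. 273) and 17.13]
[cite: GreenbergLNM1716, §4 pp. 112–113 (split l_v) and Prop. 4.14 (p. 124)] [cite: Cesnavicius2018, Thm. 1.2]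
[cite: GreenbergStevens1993, Introduction (0.6)] [cite: Miller2011LMS, Def. 1.1] -/
theorem bsdp_two_split_of_katoRat_of_towerGap_display {j n : ℕ}
    (hKato : O1.KatoMultiplicativeDivisibilityRat W 2)
    (h41sp : thm41Analogue_charValue_rankZero_split_baseChange_anyPrime)
    (hGS : greenberg_stevens (W := W) (p := 2))
    (hmod : nonempty_modularParametrizationData)
    (hGZK : rank_eq_analyticRank_of_analyticRank_le_one)
    (h414 : prop414_noFiniteSubmodule_of_not_dvd_torsionOrder)
    (hC : cesnavicius_not_two_dvd_maninConstant_of_two_dvd_level)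
    (hgap : TowerGapAtTwo W) (hirr : Irr W 2)
    (hr : W.analyticRank = 0) (hmult : Mult W 2) (hsp : W.HasSplitMultiplicativeReductionAtPrime 2)
    (hlan : X2.AnalyticLambdaEq W 2 (n + 1)) (hμan : X2.AnalyticMuLE W 2 0)
    (hsel : ∀ κ : ZpExtension ℚ 2, κ.IsCyclotomic →
      2 ^ n ≤ Nat.card {z : W.selmerLayer κ j // 2 • z = 0}) : BSDp W 2 :=
  bsdp_two_split_of_katoRat_of_towerGap_of_layerSelmer W hKato h41sp hGS hmod hGZK h414
    (periodRatio_nonneg_of_irr_of_cesnavicius W hC hmult hirr) hgap (TowerClass.not_two_dvd_torsionOrder_of_irr W hirr) hr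
    hmult hsp hlan hμan hsel

end Summit.BirchSwinnertonDyer.BirchSwinnertonDyer.Theorems.MultSelmerRank

end
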